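import Literature.Geometry.Lorentzian.KerrHorizonRegularRedShift
import Literature.Geometry.Lorentzian.KerrFarKillingEnergyEstimate
import HarnessLib

/-!
# Energy boundedness for horizon-regular solutions of the Kerr wave equation: the assembly of
# Dafermos–Rodnianski–Shlapentokh-Rothman §13 modulo its two analytic inputs

(family `gr`; namespace `Literature.Geometry.Lorentzian`; written from the proving seat of the named
fact `DafermosRodnianskiShlapentokhRothman2016_energyBoundedness_horizonRegular`
(`KerrHorizonRegularWaveBoundedness.lean`); no definitions, no named facts.)

§13 of arXiv:1402.7034 proves the uniform boundedness (23) of Theorem 3.1 in three steps: the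
near-horizon region `[r₊, A₀ + δ]` by the red-shift estimate, the far region `[A₁ − δ, ∞)` by the
energy estimate of `χT`, both up to space-time integrals of the energy over the cut-off shells,
which are controlled by integrated local energy decay ((20) of Theorem 3.1 = Prop. (closedILED),
the shells being chosen off the trapped set), and the middle region `[A₀ + δ, A₁ − δ]` by the
phase-space argument of §13.1 (Props. 13.1.1–13.1.2). The first two steps are the theorems
`kerr_horizonRegular_redShift_estimate` (`KerrHorizonRegularRedShift.lean`) and
`kerr_horizonRegular_far_killingEnergy_estimate` (`KerrFarKillingEnergyEstimate.lean`). This file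
records the bookkeeping of §13.3 ("putting everything together") as an implication:

* `kerr_horizonRegular_energyBoundedness_of_shellDecay_of_middleBound` — for subextremal `(M, a)`
  and `r₀ ≤ r₊` there is `η₀ > 0` such that for every collar width `0 < η ≤ η₀`, radii
  `2M < R₁ < R₂` and admissible `F`: IF (i) the space-time integral of the energy over the near
  shell `{r₊ + η/2 ≤ r ≤ r₊ + η}` and (ii) over the far shell `{R₁ ≤ r ≤ R₂}` between `Σ̃_0` and
  `Σ̃_τ`, and (iii) the energy through `Σ̃_τ ∩ {r₊ + η/2 < r < R₂}`, are each bounded by a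
  constant times the initial energy `E_F(0)`, uniformly in `τ ≥ 0` and in the solution, THEN
  `E_F(τ) ≤ C · E_F(0)` for all `τ ≥ 0` for the class of the named fact (smooth solutions on
  `Kerr.region a r₀` with compactly supported data on `{t* = F}`).

* `DafermosRodnianskiShlapentokhRothman2016_energyBoundedness_horizonRegular_of_shellDecay_of_middleBound`
  — (i)–(iii) for ONE admissible foliation (for all small collar widths) imply the named fact
  (composition with
  `DafermosRodnianskiShlapentokhRothman2016_energyBoundedness_horizonRegular_of_exists`).

The hypotheses (i)–(iii) are NOT proved in this library: (i)–(ii) are instances of the integrated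
local energy decay statement (20) of Theorem 3.1 (for shells off the trapped set; the vendored
`DafermosRodnianskiShlapentokhRothman2016_integratedDecay` of `KerrIntegratedDecay.lean` is the
derivative-losing (25) and does not suffice), (iii) is Proposition 13.1.2 (phase space: Carter's
separation, the frequency-localised currents of §8, `𝒫_trap`). With them for one admissible `F₀`,
the named fact follows by `DafermosRodnianskiShlapentokhRothman2016_energyBoundedness_horizonRegular_of_exists`
(`KerrHorizonRegularWaveBoundednessReduction.lean`).

## References

* M. Dafermos, I. Rodnianski, Y. Shlapentokh-Rothman, Ann. of Math. 183 (2016), arXiv:1402.7034,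
  Thm. 3.1, §13 (Prop. 13.1, §13.2, §13.3) (key `DafermosRodnianskiShlapentokhrothman2014`).
-/

noncomputable section

open Set Filter Metric MeasureTheory
open scoped Topology Manifold ContDiff ENNReal

namespace Literature.Geometry.Lorentzian

/-- The graph energy is at most the sum of its parts over three sets covering `E3`
(`lintegral_union_le`). [folklore] -/
theorem graphSliceEnergy_le_add_add (U : TopologicalSpace.Opens E4) (ψ : U → ℝ) (F : E3 → ℝ)
    (τ : ℝ) {S₁ S₂ S₃ : Set E3} (h : S₁ ∪ S₂ ∪ S₃ = Set.univ) :
    graphSliceEnergy U ψ F τ ≤ graphSliceEnergyOn U ψ F τ S₁ + graphSliceEnergyOn U ψ F τ S₂ +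
      graphSliceEnergyOn U ψ F τ S₃ := by
  rw [← graphSliceEnergyOn_univ, ← h]
  unfold graphSliceEnergyOn
  exact (lintegral_union_le _ _ _).trans (add_le_add (lintegral_union_le _ _ _) le_rfl)

/-- **Energy boundedness for horizon-regular solutions from the near-horizon and far-region
estimates, modulo shell decay and the middle-region bound** (the §13.3 assembly of
Dafermos–Rodnianski–Shlapentokh-Rothman arXiv:1402.7034). For subextremal `(M, a)` and `r₀ ≤ r₊`
there is `η₀ > 0` such that for all `0 < η ≤ η₀`, `2M < R₁ < R₂` and admissible `F`, writing
`E(u; S)` for the coordinate energy of `ψ|_{r > r₊}` through `{t* = u + F} ∩ {y : r ∈ S}`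
(`graphSliceEnergyOn`) and `E(u)` for the total: if there are finite `B₁, B₂, B₃` with
(i) `∫_{(0,τ]} E(u; [r₊ + η/2, r₊ + η]) du ≤ B₁ E(0)`, (ii) `∫_{(0,τ]} E(u; [R₁, R₂]) du ≤ B₂ E(0)`,
(iii) `E(τ; (r₊ + η/2, R₂)) ≤ B₃ E(0)` for all `τ ≥ 0` and all smooth `ψ : Kerr.region a r₀ → ℝ`
solving `□_g ψ = 0` on `{r > r₊}` with compactly supported data on `{t* = F}`, then there is
`C < ∞` with `E(τ) ≤ C E(0)` for all such `ψ` and all `τ ≥ 0`. Proof: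
`E(τ) ≤ E(τ; r ≤ r₊ + η/2) + E(τ; (r₊ + η/2, R₂)) + E(τ; r ≥ R₂)`, the red-shift estimate
`kerr_horizonRegular_redShift_estimate` for the first term, the `χT` estimate
`kerr_horizonRegular_far_killingEnergy_estimate` for the third, (i)–(iii), and `E(0; S) ≤ E(0)`.
The hypotheses are (20) of Thm. 3.1 on shells off the trapped set and Prop. 13.1.2; they are not
proved here. [cite: DafermosRodnianskiShlapentokhrothman2014, §13.3 with §13.2 and Prop. 13.1] -/
theorem kerr_horizonRegular_energyBoundedness_of_shellDecay_of_middleBound [Kerr.Facts]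
    [Kerr.SliceFacts] {M a r₀ : ℝ} (hMa : Kerr.IsSubextremal M a) (hr : r₀ ≤ Kerr.rPlus M a) :
    ∃ η₀ : ℝ, 0 < η₀ ∧ ∀ η : ℝ, 0 < η → η ≤ η₀ → ∀ R₁ R₂ : ℝ, 2 * M < R₁ → R₁ < R₂ →
      ∀ F : E3 → ℝ, Kerr.IsAdmissibleHeight M F →
      (∃ B : ℝ≥0∞, B < ⊤ ∧ ∀ ψ : Kerr.region a r₀ → ℝ,
        ContMDiff 𝓘(ℝ, E4) 𝓘(ℝ, ℝ) ∞ ψ →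
        (∀ x : Kerr.region a r₀, Kerr.rPlus M a < Kerr.radius a (x : E4) →
          (Kerr.smoothMetric M a r₀).toPseudoRiemannianMetric.dalembertian ψ x = 0) →
        (∃ ρ : ℝ, ∀ x : Kerr.region a r₀, (x : E4) 0 = F (E4.spatial (x : E4)) →
            ρ < E4.spatialNorm (x : E4) → ψ x = 0 ∧ mfderiv 𝓘(ℝ, E4) 𝓘(ℝ, ℝ) ψ x = 0) →
        ∀ τ : ℝ, 0 ≤ τ →
          ∫⁻ u in Set.Ioc 0 τ, graphSliceEnergyOn (Kerr.exterior M a)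
              (fun y : Kerr.exterior M a ↦ ψ ⟨(y : E4), Kerr.region_mono a hr y.2⟩) F u
              {y | Kerr.rPlus M a + η / 2 ≤ Kerr.radius a (E4.ofTimeSpace (u + F y) y) ∧
                Kerr.radius a (E4.ofTimeSpace (u + F y) y) ≤ Kerr.rPlus M a + η} ≤
            B * graphSliceEnergy (Kerr.exterior M a)
              (fun y : Kerr.exterior M a ↦ ψ ⟨(y : E4), Kerr.region_mono a hr y.2⟩) F 0) →
      (∃ B : ℝ≥0∞, B < ⊤ ∧ ∀ ψ : Kerr.region a r₀ → ℝ,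
        ContMDiff 𝓘(ℝ, E4) 𝓘(ℝ, ℝ) ∞ ψ →
        (∀ x : Kerr.region a r₀, Kerr.rPlus M a < Kerr.radius a (x : E4) →
          (Kerr.smoothMetric M a r₀).toPseudoRiemannianMetric.dalembertian ψ x = 0) →
        (∃ ρ : ℝ, ∀ x : Kerr.region a r₀, (x : E4) 0 = F (E4.spatial (x : E4)) →
            ρ < E4.spatialNorm (x : E4) → ψ x = 0 ∧ mfderiv 𝓘(ℝ, E4) 𝓘(ℝ, ℝ) ψ x = 0) →
        ∀ τ : ℝ, 0 ≤ τ →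
          ∫⁻ u in Set.Ioc 0 τ, graphSliceEnergyOn (Kerr.exterior M a)
              (fun y : Kerr.exterior M a ↦ ψ ⟨(y : E4), Kerr.region_mono a hr y.2⟩) F u
              {y | R₁ ≤ Kerr.radius a (E4.ofTimeSpace (u + F y) y) ∧
                Kerr.radius a (E4.ofTimeSpace (u + F y) y) ≤ R₂} ≤
            B * graphSliceEnergy (Kerr.exterior M a)
              (fun y : Kerr.exterior M a ↦ ψ ⟨(y : E4), Kerr.region_mono a hr y.2⟩) F 0) →
      (∃ B : ℝ≥0∞, B < ⊤ ∧ ∀ ψ : Kerr.region a r₀ → ℝ,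
        ContMDiff 𝓘(ℝ, E4) 𝓘(ℝ, ℝ) ∞ ψ →
        (∀ x : Kerr.region a r₀, Kerr.rPlus M a < Kerr.radius a (x : E4) →
          (Kerr.smoothMetric M a r₀).toPseudoRiemannianMetric.dalembertian ψ x = 0) →
        (∃ ρ : ℝ, ∀ x : Kerr.region a r₀, (x : E4) 0 = F (E4.spatial (x : E4)) →
            ρ < E4.spatialNorm (x : E4) → ψ x = 0 ∧ mfderiv 𝓘(ℝ, E4) 𝓘(ℝ, ℝ) ψ x = 0) →
        ∀ τ : ℝ, 0 ≤ τ →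
          graphSliceEnergyOn (Kerr.exterior M a)
              (fun y : Kerr.exterior M a ↦ ψ ⟨(y : E4), Kerr.region_mono a hr y.2⟩) F τ
              {y | Kerr.rPlus M a + η / 2 < Kerr.radius a (E4.ofTimeSpace (τ + F y) y) ∧
                Kerr.radius a (E4.ofTimeSpace (τ + F y) y) < R₂} ≤
            B * graphSliceEnergy (Kerr.exterior M a)
              (fun y : Kerr.exterior M a ↦ ψ ⟨(y : E4), Kerr.region_mono a hr y.2⟩) F 0) →
      ∃ C : ℝ≥0∞, C < ⊤ ∧ ∀ ψ : Kerr.region a r₀ → ℝ,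
        ContMDiff 𝓘(ℝ, E4) 𝓘(ℝ, ℝ) ∞ ψ →
        (∀ x : Kerr.region a r₀, Kerr.rPlus M a < Kerr.radius a (x : E4) →
          (Kerr.smoothMetric M a r₀).toPseudoRiemannianMetric.dalembertian ψ x = 0) →
        (∃ ρ : ℝ, ∀ x : Kerr.region a r₀, (x : E4) 0 = F (E4.spatial (x : E4)) →
            ρ < E4.spatialNorm (x : E4) → ψ x = 0 ∧ mfderiv 𝓘(ℝ, E4) 𝓘(ℝ, ℝ) ψ x = 0) →
        ∀ τ : ℝ, 0 ≤ τ →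
          graphSliceEnergy (Kerr.exterior M a)
              (fun y : Kerr.exterior M a ↦ ψ ⟨(y : E4), Kerr.region_mono a hr y.2⟩) F τ ≤
            C * graphSliceEnergy (Kerr.exterior M a)
              (fun y : Kerr.exterior M a ↦ ψ ⟨(y : E4), Kerr.region_mono a hr y.2⟩) F 0 := by
  obtain ⟨η₀, hη₀, hnear₀⟩ := kerr_horizonRegular_redShift_estimate hMa hr
  refine ⟨η₀, hη₀, fun η hη hηle R₁ R₂ hR₁ hR F hF h₁ h₂ h₃ ↦ ?_⟩
  obtain ⟨C₁, hC₁, hnear⟩ := hnear₀ η hη hηle F hF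
  obtain ⟨C₂, hC₂, hfar⟩ := kerr_horizonRegular_far_killingEnergy_estimate hMa hr hR₁ hR hF
  obtain ⟨B₁, hB₁, h₁⟩ := h₁
  obtain ⟨B₂, hB₂, h₂⟩ := h₂
  obtain ⟨B₃, hB₃, h₃⟩ := h₃
  refine ⟨C₁ * (1 + B₁) + B₃ + C₂ * (1 + B₂), ?_, fun ψ hψ hwave hdata τ hτ ↦ ?_⟩
  · have h1 : (1 : ℝ≥0∞) + B₁ < ⊤ := ENNReal.add_lt_top.mpr ⟨ENNReal.one_lt_top, hB₁⟩
    have h2 : (1 : ℝ≥0∞) + B₂ < ⊤ := ENNReal.add_lt_top.mpr ⟨ENNReal.one_lt_top, hB₂⟩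
    exact ENNReal.add_lt_top.mpr ⟨ENNReal.add_lt_top.mpr ⟨ENNReal.mul_lt_top hC₁ h1, hB₃⟩,
      ENNReal.mul_lt_top hC₂ h2⟩
  set ψ' : Kerr.exterior M a → ℝ := fun y ↦ ψ ⟨(y : E4), Kerr.region_mono a hr y.2⟩ with hψ'
  set E0 : ℝ≥0∞ := graphSliceEnergy (Kerr.exterior M a) ψ' F 0 with hE0
  -- the three radial pieces at time `τ`
  set Sn : Set E3 := {y | Kerr.radius a (E4.ofTimeSpace (τ + F y) y) ≤ Kerr.rPlus M a + η / 2}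
    with hSn
  set Sm : Set E3 := {y | Kerr.rPlus M a + η / 2 < Kerr.radius a (E4.ofTimeSpace (τ + F y) y) ∧
    Kerr.radius a (E4.ofTimeSpace (τ + F y) y) < R₂} with hSm
  set Sf : Set E3 := {y | R₂ ≤ Kerr.radius a (E4.ofTimeSpace (τ + F y) y)} with hSf
  have hcover : Sn ∪ Sm ∪ Sf = Set.univ := by
    ext y
    simp only [Set.mem_union, Set.mem_setOf_eq, Set.mem_univ, iff_true, hSn, hSm, hSf]
    rcases le_or_gt (Kerr.radius a (E4.ofTimeSpace (τ + F y) y)) (Kerr.rPlus M a + η / 2)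
      with h | h
    · exact Or.inl (Or.inl h)
    · rcases lt_or_ge (Kerr.radius a (E4.ofTimeSpace (τ + F y) y)) R₂ with h' | h'
      · exact Or.inl (Or.inr ⟨h, h'⟩)
      · exact Or.inr h'
  have hsplit := graphSliceEnergy_le_add_add (Kerr.exterior M a) ψ' F τ hcover
  -- the estimates
  have en := hnear ψ hψ hwave τ hτ
  have ef := hfar ψ hψ hwave hdata τ hτ
  have e₁ := h₁ ψ hψ hwave hdata τ hτ
  have e₂ := h₂ ψ hψ hwave hdata τ hτ
  have e₃ := h₃ ψ hψ hwave hdata τ hτ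
  have em₁ : graphSliceEnergyOn (Kerr.exterior M a) ψ' F 0
      {y | Kerr.radius a (E4.ofTimeSpace (0 + F y) y) ≤ Kerr.rPlus M a + η} ≤ E0 :=
    graphSliceEnergyOn_le _ _ _ _ _
  have em₂ : graphSliceEnergyOn (Kerr.exterior M a) ψ' F 0
      {y | R₁ ≤ Kerr.radius a (E4.ofTimeSpace (0 + F y) y)} ≤ E0 :=
    graphSliceEnergyOn_le _ _ _ _ _
  -- the near piece
  have hn : graphSliceEnergyOn (Kerr.exterior M a) ψ' F τ Sn ≤ C₁ * (1 + B₁) * E0 := by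
    calc graphSliceEnergyOn (Kerr.exterior M a) ψ' F τ Sn
        ≤ graphSliceEnergyOn (Kerr.exterior M a) ψ' F τ Sn +
            ∫⁻ u in Set.Ioc 0 τ, graphSliceEnergyOn (Kerr.exterior M a) ψ' F u
              {y | Kerr.radius a (E4.ofTimeSpace (u + F y) y) ≤ Kerr.rPlus M a + η / 2} :=
          le_self_add
      _ ≤ C₁ * (graphSliceEnergyOn (Kerr.exterior M a) ψ' F 0
              {y | Kerr.radius a (E4.ofTimeSpace (0 + F y) y) ≤ Kerr.rPlus M a + η} +
            ∫⁻ u in Set.Ioc 0 τ, graphSliceEnergyOn (Kerr.exterior M a) ψ' F u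
              {y | Kerr.rPlus M a + η / 2 ≤ Kerr.radius a (E4.ofTimeSpace (u + F y) y) ∧
                Kerr.radius a (E4.ofTimeSpace (u + F y) y) ≤ Kerr.rPlus M a + η}) := en
      _ ≤ C₁ * (E0 + B₁ * E0) := by gcongr
      _ = C₁ * (1 + B₁) * E0 := by ring
  -- the far piece
  have hf : graphSliceEnergyOn (Kerr.exterior M a) ψ' F τ Sf ≤ C₂ * (1 + B₂) * E0 := by
    calc graphSliceEnergyOn (Kerr.exterior M a) ψ' F τ Sf
        ≤ C₂ * (graphSliceEnergyOn (Kerr.exterior M a) ψ' F 0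
              {y | R₁ ≤ Kerr.radius a (E4.ofTimeSpace (0 + F y) y)} +
            ∫⁻ u in Set.Ioc 0 τ, graphSliceEnergyOn (Kerr.exterior M a) ψ' F u
              {y | R₁ ≤ Kerr.radius a (E4.ofTimeSpace (u + F y) y) ∧
                Kerr.radius a (E4.ofTimeSpace (u + F y) y) ≤ R₂}) := ef
      _ ≤ C₂ * (E0 + B₂ * E0) := by gcongr
      _ = C₂ * (1 + B₂) * E0 := by ring
  -- the middle piece
  have hm : graphSliceEnergyOn (Kerr.exterior M a) ψ' F τ Sm ≤ B₃ * E0 := e₃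
  calc graphSliceEnergy (Kerr.exterior M a) ψ' F τ
      ≤ graphSliceEnergyOn (Kerr.exterior M a) ψ' F τ Sn +
          graphSliceEnergyOn (Kerr.exterior M a) ψ' F τ Sm +
          graphSliceEnergyOn (Kerr.exterior M a) ψ' F τ Sf := hsplit
    _ ≤ C₁ * (1 + B₁) * E0 + B₃ * E0 + C₂ * (1 + B₂) * E0 := add_le_add (add_le_add hn hm) hf
    _ = (C₁ * (1 + B₁) + B₃ + C₂ * (1 + B₂)) * E0 := by ring

/-- **The named fact from shell decay and the middle-region bound for one admissible foliation**
(the full reduction of this library: §3.3 ⇒ one foliation,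
`DafermosRodnianskiShlapentokhRothman2016_energyBoundedness_horizonRegular_of_exists`; §13.3 ⇒ the
near/far estimates, `kerr_horizonRegular_energyBoundedness_of_shellDecay_of_middleBound`). If for
every subextremal `(M, a)`, `r₋ < r₀ < r₊` and every `η₀ > 0` there are a collar width
`0 < η ≤ η₀`, radii `2M < R₁ < R₂` and ONE admissible height function `F₀` for which (i) the
space-time integral of the energy over the near shell `{r₊ + η/2 ≤ r ≤ r₊ + η}` and (ii) over the
far shell `{R₁ ≤ r ≤ R₂}`, and (iii) the energy through `{t* = τ + F₀} ∩ {r₊ + η/2 < r < R₂}`, are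
bounded by a constant times the initial energy for the horizon-regular class, then
`DafermosRodnianskiShlapentokhRothman2016_energyBoundedness_horizonRegular` holds. The hypothesis is
the analytic core of arXiv:1402.7034 — (20) of Theorem 3.1 on shells off the trapped set (§§5–12)
and Proposition 13.1.2 (§13.1) — and is NOT proved in this library.
[cite: DafermosRodnianskiShlapentokhrothman2014, Thm. 3.1 (20), (23), §13] -/
theorem DafermosRodnianskiShlapentokhRothman2016_energyBoundedness_horizonRegular_of_shellDecay_of_middleBound
    (h : ∀ [Kerr.Facts] [Kerr.SliceFacts] (M a r₀ : ℝ) (hr : r₀ < Kerr.rPlus M a),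
      Kerr.IsSubextremal M a → Kerr.rMinus M a < r₀ → ∀ η₀ : ℝ, 0 < η₀ →
      ∃ η : ℝ, 0 < η ∧ η ≤ η₀ ∧ ∃ R₁ R₂ : ℝ, 2 * M < R₁ ∧ R₁ < R₂ ∧
      ∃ F : E3 → ℝ, Kerr.IsAdmissibleHeight M F ∧
          (∃ B : ℝ≥0∞, B < ⊤ ∧ ∀ ψ : Kerr.region a r₀ → ℝ,
          ContMDiff 𝓘(ℝ, E4) 𝓘(ℝ, ℝ) ∞ ψ →
          (∀ x : Kerr.region a r₀, Kerr.rPlus M a < Kerr.radius a (x : E4) →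
            (Kerr.smoothMetric M a r₀).toPseudoRiemannianMetric.dalembertian ψ x = 0) →
          (∃ ρ : ℝ, ∀ x : Kerr.region a r₀, (x : E4) 0 = F (E4.spatial (x : E4)) →
              ρ < E4.spatialNorm (x : E4) → ψ x = 0 ∧ mfderiv 𝓘(ℝ, E4) 𝓘(ℝ, ℝ) ψ x = 0) →
          ∀ τ : ℝ, 0 ≤ τ →
            ∫⁻ u in Set.Ioc 0 τ, graphSliceEnergyOn (Kerr.exterior M a)
                (fun y : Kerr.exterior M a ↦ ψ ⟨(y : E4), Kerr.region_mono a hr.le y.2⟩) F u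
                {y | Kerr.rPlus M a + η / 2 ≤ Kerr.radius a (E4.ofTimeSpace (u + F y) y) ∧
                  Kerr.radius a (E4.ofTimeSpace (u + F y) y) ≤ Kerr.rPlus M a + η} ≤
              B * graphSliceEnergy (Kerr.exterior M a)
                (fun y : Kerr.exterior M a ↦ ψ ⟨(y : E4), Kerr.region_mono a hr.le y.2⟩) F 0) ∧
          (∃ B : ℝ≥0∞, B < ⊤ ∧ ∀ ψ : Kerr.region a r₀ → ℝ,
          ContMDiff 𝓘(ℝ, E4) 𝓘(ℝ, ℝ) ∞ ψ →
          (∀ x : Kerr.region a r₀, Kerr.rPlus M a < Kerr.radius a (x : E4) →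
            (Kerr.smoothMetric M a r₀).toPseudoRiemannianMetric.dalembertian ψ x = 0) →
          (∃ ρ : ℝ, ∀ x : Kerr.region a r₀, (x : E4) 0 = F (E4.spatial (x : E4)) →
              ρ < E4.spatialNorm (x : E4) → ψ x = 0 ∧ mfderiv 𝓘(ℝ, E4) 𝓘(ℝ, ℝ) ψ x = 0) →
          ∀ τ : ℝ, 0 ≤ τ →
            ∫⁻ u in Set.Ioc 0 τ, graphSliceEnergyOn (Kerr.exterior M a)
                (fun y : Kerr.exterior M a ↦ ψ ⟨(y : E4), Kerr.region_mono a hr.le y.2⟩) F u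
                {y | R₁ ≤ Kerr.radius a (E4.ofTimeSpace (u + F y) y) ∧
                  Kerr.radius a (E4.ofTimeSpace (u + F y) y) ≤ R₂} ≤
              B * graphSliceEnergy (Kerr.exterior M a)
                (fun y : Kerr.exterior M a ↦ ψ ⟨(y : E4), Kerr.region_mono a hr.le y.2⟩) F 0) ∧
          (∃ B : ℝ≥0∞, B < ⊤ ∧ ∀ ψ : Kerr.region a r₀ → ℝ,
          ContMDiff 𝓘(ℝ, E4) 𝓘(ℝ, ℝ) ∞ ψ →
          (∀ x : Kerr.region a r₀, Kerr.rPlus M a < Kerr.radius a (x : E4) →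
            (Kerr.smoothMetric M a r₀).toPseudoRiemannianMetric.dalembertian ψ x = 0) →
          (∃ ρ : ℝ, ∀ x : Kerr.region a r₀, (x : E4) 0 = F (E4.spatial (x : E4)) →
              ρ < E4.spatialNorm (x : E4) → ψ x = 0 ∧ mfderiv 𝓘(ℝ, E4) 𝓘(ℝ, ℝ) ψ x = 0) →
          ∀ τ : ℝ, 0 ≤ τ →
            graphSliceEnergyOn (Kerr.exterior M a)
                (fun y : Kerr.exterior M a ↦ ψ ⟨(y : E4), Kerr.region_mono a hr.le y.2⟩) F τ
                {y | Kerr.rPlus M a + η / 2 < Kerr.radius a (E4.ofTimeSpace (τ + F y) y) ∧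
                  Kerr.radius a (E4.ofTimeSpace (τ + F y) y) < R₂} ≤
              B * graphSliceEnergy (Kerr.exterior M a)
                (fun y : Kerr.exterior M a ↦ ψ ⟨(y : E4), Kerr.region_mono a hr.le y.2⟩) F 0)) :
    DafermosRodnianskiShlapentokhRothman2016_energyBoundedness_horizonRegular := by
  refine DafermosRodnianskiShlapentokhRothman2016_energyBoundedness_horizonRegular_of_exists
    fun M a r₀ hr hMa hrm ↦ ?_
  obtain ⟨η₀, hη₀, hasm⟩ :=
    kerr_horizonRegular_energyBoundedness_of_shellDecay_of_middleBound hMa hr.le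
  obtain ⟨η, hη, hηle, R₁, R₂, hR₁, hR, F₀, hF₀, h₁, h₂, h₃⟩ := h M a r₀ hr hMa hrm η₀ hη₀
  exact ⟨F₀, hF₀, hasm η hη hηle R₁ R₂ hR₁ hR F₀ hF₀ h₁ h₂ h₃⟩

end Literature.Geometry.Lorentzian
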